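/-
Copyright (c) 2026. All rights reserved.
Released under Apache 2.0 license as described in the file LICENSE.
Authors: abc-iut cell, block-F seat abc-iut-f-083 (gen 7), L6 register row LF6-45.
-/
import Literature.IUT.LogThetaLattice.LogWallRemarksProofs
import Literature.IUT.LogThetaLattice.LocalLogShellsProofs
import HarnessLib

/-!
# [IUTchIII] Rmk 1.2.4 (i) / [AbsTopIII] §I4 "log-wall": the label of the schema `NotFromRingHom` decided

Proof-only companion (theorems only; no `def`, no named fact) of `LogWallRemarks.lean` (abc-iut-L6-t1,
the typing `Literature.IUT.LogThetaLattice.NotFromRingHom`, FACT-LIST row F-0430) and of its junction file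
`LogWallRemarksProofs.lean` (abc-iut-L6-t9: `notFromRingHom_iff_nontrivial`,
`notFromRingHom_valuationSubring`, `notFromRingHom_field`).

Mochizuki, *Inter-universal Teichmüller Theory III*, §1, Remark 1.2.4 (i) (kurims manuscript p. 39
l. 38–46): the log-link "is incompatible with the ring structures of `Ψ^gp_{†ℱ_v}` and `Ψ^gp_{log(†ℱ_v)}`
[...] in the sense that it does not arise from a ring homomorphism between these two rings" — the
"log-wall" of *Topics in Absolute Anabelian Geometry III*, §I4.  The tree types this sentence as the
PARAMETRISED predicate `NotFromRingHom R₁ R₂ lg` (rings `R₁`, `R₂`; `lg : R₁ˣ →* Multiplicative R₂` the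
map underlying the log-link on units).

This file DECIDES the label of that schema in the kernel, in the cell's standard two-line form:

* `not_forall_notFromRingHom` — the BARE UNIVERSAL CLOSURE over all rings `R₁`, `R₂` and all `lg` is
  FALSE: over the zero ring `R₂` the zero map is a ring homomorphism restricting to `lg`
  (`not_notFromRingHom_of_subsingleton`).  This refutes only the bare closure of the typed schema, which
  nobody asserts in print (the printed rings are `k̄_v` with its two ring structures, never the zero ring);
  `forall_notFromRingHom_iff_false` records the closure's exact truth value.
* the INSTANCE FORMS are theorems: at every nontrivial `R₂` (`notFromRingHom_of_map_one`, L6-t1; exact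
  characterisation `notFromRingHom_iff_nontrivial`, L6-t9), and — assembled here BY NAME at the model of
  record of the nonarchimedean log-link — at THE `p`-adic logarithm `unitLog = log_p : 𝒪_K^× → K` of an MLF
  `K` in the norm-side description (abc-iut-S1, `Literature.IUT.LogVolume.unitLog`, Neukirch ANT II
  (5.4)–(5.5)) on ITS ring of integers `𝒪_K = {‖x‖ ≤ 1}` (`notFromRingHom_unitLog`), and binder-free at
  `K = ℚ_p` itself (`notFromRingHom_unitLog_padic`).

HONEST FRAMING: Rmk 1.2.4 (i) is an EXPOSITORY remark recalling a classical phenomenon (`log(xy) =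
log x + log y`, `log 1 = 0 ≠ 1`); F-0430 is a hypothesis-class reading row of the cell's FACT-LIST, not
a prerequisite of [IUTchIII] Cor. 3.12, and nothing here bears on Cor. 3.12.  Refuting the bare closure
of OUR typed schema is a statement about the typing, not about the text; no side is taken on any author;
nothing here asserts abc proved or refuted. [claim: Mochizuki2012, status: disputed]
(IUTchIII §1 Rmk 1.2.4 (i), kurims p.39)
-/

noncomputable section

namespace Literature.IUT.LogThetaLattice

open Literature.IUT.LogVolume

universe u

/-! ## The bare universal closure of the schema is false (zero target ring) -/

/-- Over the ZERO ring `R₂` the typed log-wall predicate FAILS for every `lg`: the zero map `R₁ → R₂` is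
a ring homomorphism and agrees with `lg` on units (everything in `R₂` is `0`).  (The `←` half of
abc-iut-L6-t9's `notFromRingHom_iff_nontrivial`, stated as a negative instance.)
[claim: Mochizuki2012, status: disputed] (IUTchIII §1 Rmk 1.2.4 (i), kurims p.39) -/
theorem not_notFromRingHom_of_subsingleton {R₁ R₂ : Type u} [Ring R₁] [Ring R₂] [Subsingleton R₂]
    (lg : R₁ˣ →* Multiplicative R₂) : ¬ NotFromRingHom R₁ R₂ lg := fun h =>
  not_nontrivial R₂ ((notFromRingHom_iff_nontrivial lg).mp h)

/-- **The bare universal closure of the schema `NotFromRingHom` is FALSE** (FACT-LIST F-0430, label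
decision "universal closure REFUTED / schema; instance forms are the content"): witness `R₁ = R₂ =` the
zero ring `PUnit`, `lg` trivial.  This refutes ONLY the closure of the typed schema over ALL pairs of
rings — the printed sentence concerns the two (nonzero) ring structures on `k̄_v`, where the instance
form holds (`notFromRingHom_of_map_one`, `notFromRingHom_unitLog`).
[claim: Mochizuki2012, status: disputed] (IUTchIII §1 Rmk 1.2.4 (i), kurims p.39) -/
theorem not_forall_notFromRingHom :
    ¬ ∀ (R₁ R₂ : Type u) [Ring R₁] [Ring R₂] (lg : R₁ˣ →* Multiplicative R₂),
      NotFromRingHom R₁ R₂ lg :=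
  fun h => not_notFromRingHom_of_subsingleton (R₁ := PUnit.{u + 1}) (R₂ := PUnit.{u + 1}) 1 (h _ _ 1)

/-- The closure's exact truth value, for the label books: `(∀ R₁ R₂ lg, NotFromRingHom R₁ R₂ lg) ↔ False`,
while pointwise `NotFromRingHom R₁ R₂ lg ↔ Nontrivial R₂` (`notFromRingHom_iff_nontrivial`).
[claim: Mochizuki2012, status: disputed] (IUTchIII §1 Rmk 1.2.4 (i), kurims p.39) -/
theorem forall_notFromRingHom_iff_false :
    (∀ (R₁ R₂ : Type u) [Ring R₁] [Ring R₂] (lg : R₁ˣ →* Multiplicative R₂),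
      NotFromRingHom R₁ R₂ lg) ↔ False :=
  iff_false_intro not_forall_notFromRingHom

/-! ## The instance form at THE `p`-adic logarithm of record -/

/-- **The log-wall at the model of record of the nonarchimedean log-link.**  `K` an MLF in the norm-side
description (a proper ultrametric normed field and normed `ℚ_p`-algebra), `𝒪_K` ITS ring of integers
(the valuation subring with `x ∈ 𝒪_K ↔ ‖x‖ ≤ 1`; it exists, `exists_valuationSubring_iff_norm_le_one`):
the `p`-adic logarithm `log_p = unitLog` (abc-iut-S1) IS a homomorphism `logk : 𝒪_K^× → (K, +)`
(`exists_addMonoidHom_eq_unitLog`, abc-iut-L3-t11), and NO ring homomorphism `𝒪_K → K` restricts to it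
on `𝒪_K^×` (`notFromRingHom_valuationSubring`, abc-iut-L6-t9).  Zero assumption-class binders: the data
are `p`, `K`, `𝒪_K` and the defining property `hO` of `𝒪_K`.
[claim: Mochizuki2012, status: disputed] (IUTchIII §1 Rmk 1.2.4 (i), kurims p.39) -/
theorem notFromRingHom_unitLog (p : ℕ) [Fact p.Prime] (K : Type u) [NontriviallyNormedField K]
    [NormedAlgebra ℚ_[p] K] [IsUltrametricDist K] [ProperSpace K] (O : ValuationSubring K)
    (hO : ∀ x : K, x ∈ O ↔ ‖x‖ ≤ 1) :
    ∃ logk : Additive (↥O)ˣ →+ K,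
      (∀ u : (↥O)ˣ, logk (Additive.ofMul u) = unitLog ((u : ↥O) : K)) ∧
        NotFromRingHom (↥O) K (AddMonoidHom.toMultiplicativeRight logk) := by
  obtain ⟨logk, hlogk⟩ := exists_addMonoidHom_eq_unitLog p O hO
  exact ⟨logk, hlogk, notFromRingHom_valuationSubring O logk⟩

/-- **The log-wall at `ℚ_p` itself, binder-free**: with `𝒪 = ℤ_p ⊆ ℚ_p` presented as the valuation
subring `{‖x‖ ≤ 1}` and `log_p = unitLog` on `ℤ_p^×`, no ring homomorphism `ℤ_p → ℚ_p` restricts to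
`log_p` on the units.  The only datum is the prime `p`.
[claim: Mochizuki2012, status: disputed] (IUTchIII §1 Rmk 1.2.4 (i), kurims p.39) -/
theorem notFromRingHom_unitLog_padic (p : ℕ) [Fact p.Prime] :
    ∃ (O : ValuationSubring ℚ_[p]) (logk : Additive (↥O)ˣ →+ ℚ_[p]),
      (∀ x : ℚ_[p], x ∈ O ↔ ‖x‖ ≤ 1) ∧
        (∀ u : (↥O)ˣ, logk (Additive.ofMul u) = unitLog ((u : ↥O) : ℚ_[p])) ∧
          NotFromRingHom (↥O) ℚ_[p] (AddMonoidHom.toMultiplicativeRight logk) := by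
  obtain ⟨O, hO⟩ := exists_valuationSubring_iff_norm_le_one (K := ℚ_[p])
  obtain ⟨logk, hlogk, hwall⟩ := notFromRingHom_unitLog p ℚ_[p] O hO
  exact ⟨O, logk, hO, hlogk, hwall⟩

/-- **Label decision for F-0430 in one statement**: the bare closure of the schema is false AND the
instance form holds at every nontrivial target ring (in particular at both printed ring structures on
`k̄_v`, fields). [claim: Mochizuki2012, status: disputed] (IUTchIII §1 Rmk 1.2.4 (i), kurims p.39) -/
theorem notFromRingHom_label_decided :
    (¬ ∀ (R₁ R₂ : Type u) [Ring R₁] [Ring R₂] (lg : R₁ˣ →* Multiplicative R₂),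
        NotFromRingHom R₁ R₂ lg) ∧
      ∀ (R₁ R₂ : Type u) [Ring R₁] [Ring R₂] [Nontrivial R₂] (lg : R₁ˣ →* Multiplicative R₂),
        NotFromRingHom R₁ R₂ lg :=
  ⟨not_forall_notFromRingHom, fun _ _ _ _ _ lg => notFromRingHom_of_map_one lg⟩

end Literature.IUT.LogThetaLattice

end
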